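import Summits.Ventures.PackingBounds.Energy.DiploSimplexAntipodal
import Summits.Ventures.PackingBounds.Energy.RieszAbsolutelyMonotone

/-!
# The diplo-simplex minimises EVERY absolutely monotonic energy among antipodal configurations (all `n ≥ 3`)

Framing: lottery ticket; floor = certified bounds/negative ranges. Venture `PackingBounds` (cell `pub-packcert`,
seat `pub-packcert-energy`, gen 26) — corollary file of `DiploSimplexAntipodal` (supporting-line form).

For `a(t) = (1+t)^k` the even part `(1+t)^k + (1-t)^k` is a polynomial in `u = t²` with non-negative
coefficients, hence convex and non-decreasing on `u ≥ 0`; `even_pow_supporting` produces its supporting slope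
`m_k ≥ 0` at `u₀ = 1/n²` by a bare induction on `k` (`H_{k+1} = H_k + W_k`, `W_{k+1} = W_k + u H_k` with
`W_k = t((1+t)^k - (1-t)^k)`). So `DiploSimplexAntipodal.energy_ge` applies to every `(1+t)^k`
(`ckPow_energy_ge`), to every `a = Σ c_k (1+t)^k`, `c_k ≥ 0` (`universally_optimal`, via
`NewtonCert.energy_ge_hasSum_of_pow`), to every `a` absolutely monotonic on `[-1,1)` (Bernstein,
`universallyOptimal_of_absolutelyMonotoneOn`) and to every Riesz potential (`riesz_energy_ge`):
for `n ≥ 3`, `p ≥ 0` and every antipodal `(2n+2)`-configuration `C ⊂ S^{n-1}`,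
`Σ_{x ≠ y} ‖x - y‖^{-2p} ≥ (2n+2)(4^{-p} + n (2 + 2/n)^{-p} + n (2 - 2/n)^{-p})`, the value of the diplo-simplex.
(Universal optimality of the `n+1` simplex lines in `ℝP^{n-1}`: Cohn–Kumar 2007 §8; Cohn–Woo 2012 §5.2.)

## References
* H. Cohn, A. Kumar, J. Amer. Math. Soc. 20 (2007) 99–148, §8. [`CohnKumar2006`]
* H. Cohn, J. Woo, J. Amer. Math. Soc. 25 (2012) 929–958, §5.2. [`CohnWoo2012`]
* B. Ballinger et al., Experiment. Math. 18 (2009) 257–283, §3.4. [`BallingerEtAl2009`]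
-/

noncomputable section

open Finset Literature.Analysis.Calculus

namespace Summit.Ventures.PackingBounds.Energy.DiploSimplexAntipodal

variable {n : ℕ}

/-! ## The even part of `(1+t)^k` has a non-negative supporting slope in `t²` -/

/-- **Even supporting slopes for `(1+t)^k`, every `k`.** For every `t₀` there are `m, w ≥ 0` with, for all real `t`,
`(1+t)^k + (1-t)^k ≥ (1+t₀)^k + (1-t₀)^k + m (t² - t₀²)` and `t((1+t)^k - (1-t)^k) ≥ t₀((1+t₀)^k - (1-t₀)^k) + w (t² - t₀²)`;
moreover `(1+t)^k + (1-t)^k ≥ 2` and `t((1+t)^k - (1-t)^k) ≥ 0`. (Both are polynomials in `u = t²` with non-negative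
coefficients — `H_{k+1} = H_k + W_k`, `W_{k+1} = W_k + u H_k` — hence convex and non-decreasing in `u ≥ 0`; the proof is the
induction on `k`, no polynomial algebra.) [folklore] -/
theorem even_pow_supporting (k : ℕ) (t₀ : ℝ) : ∃ m w : ℝ, 0 ≤ m ∧ 0 ≤ w ∧ ∀ t : ℝ,
    (1 + t₀) ^ k + (1 - t₀) ^ k + m * (t ^ 2 - t₀ ^ 2) ≤ (1 + t) ^ k + (1 - t) ^ k ∧
    t₀ * ((1 + t₀) ^ k - (1 - t₀) ^ k) + w * (t ^ 2 - t₀ ^ 2) ≤ t * ((1 + t) ^ k - (1 - t) ^ k) ∧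
    2 ≤ (1 + t) ^ k + (1 - t) ^ k ∧ 0 ≤ t * ((1 + t) ^ k - (1 - t) ^ k) := by
  induction k with
  | zero => exact ⟨0, 0, le_rfl, le_rfl, fun t => by norm_num⟩
  | succ k ih =>
    obtain ⟨m, w, hm, hw, h⟩ := ih
    have h₀ := h t₀
    refine ⟨m + w, w + ((1 + t₀) ^ k + (1 - t₀) ^ k + t₀ ^ 2 * m), add_nonneg hm hw,
      add_nonneg hw (add_nonneg (by linarith [h₀.2.2.1]) (mul_nonneg (sq_nonneg _) hm)), fun t => ?_⟩
    obtain ⟨h1, h2, h3, h4⟩ := h t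
    have eH : ∀ s : ℝ, (1 + s) ^ (k + 1) + (1 - s) ^ (k + 1) =
        ((1 + s) ^ k + (1 - s) ^ k) + s * ((1 + s) ^ k - (1 - s) ^ k) := fun s => by ring
    have eW : ∀ s : ℝ, s * ((1 + s) ^ (k + 1) - (1 - s) ^ (k + 1)) =
        s * ((1 + s) ^ k - (1 - s) ^ k) + s ^ 2 * ((1 + s) ^ k + (1 - s) ^ k) := fun s => by ring
    have hsq : t ^ 2 * ((1 + t₀) ^ k + (1 - t₀) ^ k + m * (t ^ 2 - t₀ ^ 2)) ≤
        t ^ 2 * ((1 + t) ^ k + (1 - t) ^ k) := mul_le_mul_of_nonneg_left h1 (sq_nonneg t)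
    have hmsq : 0 ≤ m * (t ^ 2 - t₀ ^ 2) ^ 2 := mul_nonneg hm (sq_nonneg _)
    refine ⟨?_, ?_, ?_, ?_⟩
    · rw [eH t, eH t₀]; linarith
    · rw [eW t, eW t₀]; nlinarith [hsq, hmsq]
    · rw [eH t]; linarith
    · rw [eW t]; nlinarith [sq_nonneg t]

/-! ## Every `(1+t)^k`, every absolutely monotonic potential, every Riesz potential -/

open scoped Classical in
/-- **Antipodal bound for `(1+t)^k`, every `k`, every `n ≥ 3`.** Every antipodal configuration of `2n+2` unit
vectors of `ℝⁿ` has `Σ_{x ≠ y} (1+⟪x,y⟫)^k ≥ (2n+2)(0^k + n (1-1/n)^k + n (1+1/n)^k)`, the value of the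
diplo-simplex. [cite: CohnKumar2006, §8] -/
theorem ckPow_energy_ge (hn : 3 ≤ n) (k : ℕ) (C : Finset (EuclideanSpace ℝ (Fin n)))
    (h1 : ∀ x ∈ C, ‖x‖ = 1) (hN : C.card = 2 * n + 2) (hanti : ∀ x ∈ C, -x ∈ C) :
    (2 * n + 2 : ℝ) * ((1 + (-1 : ℝ)) ^ k + n * (1 + -1 / (n : ℝ)) ^ k + n * (1 + 1 / (n : ℝ)) ^ k) ≤
      ∑ x ∈ C, ∑ y ∈ C.erase x, (1 + inner ℝ x y) ^ k := by
  obtain ⟨m, w, hm, -, h⟩ := even_pow_supporting k (1 / (n : ℝ))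
  have key := energy_ge hn (fun t => (1 + t) ^ k) m C h1 hN hanti hm (fun t _ _ => by
    have ht := (h t).1
    have hsq : (1 / (n : ℝ)) ^ 2 = 1 / (n : ℝ) ^ 2 := by rw [div_pow, one_pow]
    have e1 : (1 + -1 / (n : ℝ)) = 1 - 1 / (n : ℝ) := by ring
    have e2 : (1 + -t) = 1 - t := by ring
    rw [e1, e2, ← hsq]
    linarith)
  simpa using key

open scoped Classical in
/-- **Antipodal universal optimality of the diplo-simplex, power-series form** (every `n ≥ 3`): for
`a(s) = Σ_k c_k (1+s)^k` on `[-1,1)` with `c_k ≥ 0`, every antipodal configuration of `2n+2` unit vectors of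
`ℝⁿ` has `Σ_{x ≠ y} a(⟪x,y⟫) ≥ (2n+2)(a(-1) + n a(-1/n) + n a(1/n))`. [cite: CohnKumar2006, §8] -/
theorem universally_optimal (hn : 3 ≤ n) (a : ℝ → ℝ) (c : ℕ → ℝ) (hc : ∀ k, 0 ≤ c k)
    (ha : ∀ s : ℝ, -1 ≤ s → s < 1 → HasSum (fun k => c k * (1 + s) ^ k) (a s))
    (C : Finset (EuclideanSpace ℝ (Fin n))) (h1 : ∀ x ∈ C, ‖x‖ = 1) (hN : C.card = 2 * n + 2)
    (hanti : ∀ x ∈ C, -x ∈ C) :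
    (2 * n + 2 : ℝ) * (a (-1) + n * a (-1 / (n : ℝ)) + n * a (1 / (n : ℝ))) ≤
      ∑ x ∈ C, ∑ y ∈ C.erase x, a (inner ℝ x y) := by
  have hn3 : (3 : ℝ) ≤ n := by exact_mod_cast hn
  have hnpos : (0 : ℝ) < n := by linarith
  have hinv : 1 / (n : ℝ) < 1 := by rw [div_lt_one hnpos]; linarith
  have hinv0 : 0 < 1 / (n : ℝ) := by positivity
  have key := NewtonCert.energy_ge_hasSum_of_pow (n := n) (2 * n + 2) 3
    (fun i : ℕ => match i with | 0 => (-1 : ℝ) | 1 => -1 / (n : ℝ) | _ => 1 / (n : ℝ))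
    (fun i : ℕ => match i with | 0 => (1 : ℝ) | 1 => (n : ℝ) | _ => (n : ℝ))
    (fun i hi => by
      have f1 : (-1 : ℝ) ≤ -1 / (n : ℝ) := by rw [neg_div]; linarith
      have f2 : -1 / (n : ℝ) < 1 := by rw [neg_div]; linarith
      have f3 : (-1 : ℝ) ≤ 1 / (n : ℝ) := by linarith
      interval_cases i
      · exact ⟨le_rfl, by norm_num⟩
      · exact ⟨f1, f2⟩
      · exact ⟨f3, hinv⟩)
    C h1 (fun k => by
      have h := ckPow_energy_ge hn k C h1 hN hanti
      simp only [Finset.sum_range_succ, Finset.sum_range_zero] at h ⊢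
      push_cast at h ⊢
      linarith) a c hc ha
  simp only [Finset.sum_range_succ, Finset.sum_range_zero] at key
  push_cast at key
  linarith

open scoped Classical in
/-- **Antipodal universal optimality of the diplo-simplex** (every `n ≥ 3`): for every potential `a`
absolutely monotonic on `[-1,1)` (Mathlib's `AbsolutelyMonotoneOn a (Set.Ico (-1) 1)`), every antipodal
configuration of `2n+2` unit vectors of `ℝⁿ` has `a`-energy at least `(2n+2)(a(-1) + n a(-1/n) + n a(1/n))`,
the `a`-energy of the diplo-simplex (`Config.DiploSimplex.exists_config`). [cite: CohnKumar2006, §8] -/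
theorem universallyOptimal_of_absolutelyMonotoneOn (hn : 3 ≤ n) (a : ℝ → ℝ)
    (ha : AbsolutelyMonotoneOn a (Set.Ico (-1) 1))
    (C : Finset (EuclideanSpace ℝ (Fin n))) (h1 : ∀ x ∈ C, ‖x‖ = 1) (hN : C.card = 2 * n + 2)
    (hanti : ∀ x ∈ C, -x ∈ C) :
    (2 * n + 2 : ℝ) * (a (-1) + n * a (-1 / (n : ℝ)) + n * a (1 / (n : ℝ))) ≤
      ∑ x ∈ C, ∑ y ∈ C.erase x, a (inner ℝ x y) := by
  obtain ⟨c, hc, hsum⟩ := absolutelyMonotoneOn_hasSum_one_add ha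
  exact universally_optimal hn a c hc hsum C h1 hN hanti

open scoped Classical in
/-- **The diplo-simplex minimises every Riesz energy among antipodal configurations** (every `n ≥ 3`,
every `p ≥ 0`; Riesz exponent `s = 2p`, `‖x-y‖^{-s} = (2 - 2⟪x,y⟫)^{-p}`): every antipodal configuration of
`2n+2` unit vectors of `ℝⁿ` has `Σ_{x ≠ y} (2 - 2⟪x,y⟫)^{-p} ≥ (2n+2)(4^{-p} + n (2 + 2/n)^{-p} + n (2 - 2/n)^{-p})`.
[cite: CohnKumar2006, §8] -/
theorem riesz_energy_ge (hn : 3 ≤ n) (p : ℝ) (hp : 0 ≤ p)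
    (C : Finset (EuclideanSpace ℝ (Fin n))) (h1 : ∀ x ∈ C, ‖x‖ = 1) (hN : C.card = 2 * n + 2)
    (hanti : ∀ x ∈ C, -x ∈ C) :
    (2 * n + 2 : ℝ) * ((4 : ℝ) ^ (-p) + n * (2 + 2 / (n : ℝ)) ^ (-p) + n * (2 - 2 / (n : ℝ)) ^ (-p)) ≤
      ∑ x ∈ C, ∑ y ∈ C.erase x, (2 - 2 * inner ℝ x y) ^ (-p) := by
  have h := universallyOptimal_of_absolutelyMonotoneOn hn (fun t : ℝ => (2 - 2 * t) ^ (-p))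
    (RieszAbsolutelyMonotone.absolutelyMonotoneOn_rpow_chordal p hp) C h1 hN hanti
  refine le_trans (le_of_eq ?_) h
  have e1 : (2 : ℝ) - 2 * (-1) = 4 := by norm_num
  have e2 : (2 : ℝ) - 2 * (-1 / (n : ℝ)) = 2 + 2 / (n : ℝ) := by ring
  have e3 : (2 : ℝ) - 2 * (1 / (n : ℝ)) = 2 - 2 / (n : ℝ) := by ring
  simp only [e1, e2, e3]

/-- **Least antipodal Riesz energy** (every `n ≥ 3`, `p ≥ 0`): among antipodal `(2n+2)`-configurations of
`S^{n-1}` the least value of `Σ_{x ≠ y} (2 - 2⟪x,y⟫)^{-p}` is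
`(2n+2)(4^{-p} + n (2 + 2/n)^{-p} + n (2 - 2/n)^{-p})`, attained by the diplo-simplex. [cite: CohnKumar2006, §8] -/
theorem riesz_isLeast (hn : 3 ≤ n) (p : ℝ) (hp : 0 ≤ p) :
    _root_.IsLeast {E : ℝ | ∃ C : Finset (EuclideanSpace ℝ (Fin n)), C.card = 2 * n + 2 ∧
        (∀ x ∈ C, ‖x‖ = 1) ∧ (∀ x ∈ C, -x ∈ C) ∧
        E = ∑ x ∈ C, ∑ y ∈ C.erase x, (2 - 2 * inner ℝ x y) ^ (-p)}
      ((2 * n + 2 : ℝ) * ((4 : ℝ) ^ (-p) + n * (2 + 2 / (n : ℝ)) ^ (-p) + n * (2 - 2 / (n : ℝ)) ^ (-p))) := by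
  classical
  constructor
  · obtain ⟨C, hcard, h1, hZ, he⟩ := Config.DiploSimplex.exists_config n (by omega)
    refine ⟨C, hcard, h1, fun x hx => Config.DiploSimplexUnique.neg_mem hn C h1 hcard hZ hx, ?_⟩
    rw [he (fun t => (2 - 2 * t) ^ (-p))]
    have e1 : (2 : ℝ) - 2 * (-1) = 4 := by norm_num
    have e2 : (2 : ℝ) - 2 * (-1 / (n : ℝ)) = 2 + 2 / (n : ℝ) := by ring
    have e3 : (2 : ℝ) - 2 * (1 / (n : ℝ)) = 2 - 2 / (n : ℝ) := by ring
    simp only [e1, e2, e3]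
  · rintro E ⟨C, hcard, h1, hanti, rfl⟩
    exact riesz_energy_ge hn p hp C h1 hcard hanti

end Summit.Ventures.PackingBounds.Energy.DiploSimplexAntipodal

end
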